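import Mathlib
import HarnessLib

/-!
# RigidMotionDoor — the one-parameter group of rigid motions generated by an affine Killing field

Route `RigidMotionDoor` (ns-idea-6 LINE g5-3 «stabilisation»), crux `EuclidAccumulation`
(stmt-NavierStokesRegularity-27902), tool-box for the load-bearing stub `stub_forwardRigidSymmetry`.
Pure finite-dimensional calculus, no fluid mechanics:

* `star_eq_neg` — an operator `B` with `⟪B x, x⟫ = 0` is skew-adjoint; `exp_smul_mem_unitary` — `exp(τB)` is
  unitary (so `Unitary.linearIsometryEquiv ⟨exp(τB), _⟩` is a linear isometric equivalence acting as `exp(τB)`);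
* `hasDerivAt_exp_smul_apply` — `d/dτ exp(τB) z = B exp(τB) z`; `exp_smul_apply_of_map_eq_zero` — `exp(τB)` fixes
  `ker B`; `apply_exp_smul_neg_comm`, `exp_smul_apply_exp_smul_neg` — `B` commutes with `exp(−τB)` and
  `exp(τB) exp(−τB) = 1`;
* `exists_range_add_ker` — every `e` splits as `B c + e₂` with `B e₂ = 0` (orthogonal projection onto `range B`);
* the affine flow `g_τ(y) = exp(τB) y + (exp(τB) c − c + τ e₂)` of the Killing field `y ↦ B y + (B c + e₂)`
  (always written out — no definition): `flow_zero`, `hasDerivAt_flow` (`d/dτ g_τ(y) = B g_τ(y) + (B c + e₂)`);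
* `apply_flow_eq_of_fderiv` — INTEGRATION: a differentiable `f` with `Df(y)[B y + e] = B f(y)` for all `y` is
  equivariant under the flow, `f(g_τ y) = exp(τB) f(y)` (the function `τ ↦ exp(−τB) f(g_τ y)` has zero derivative);
* `fderiv_eq_of_apply_flow` — DIFFERENTIATION: conversely, finite equivariance under the flow gives the
  infinitesimal one at `τ = 0`.

Prover ns-imp-p1 g4 (author; text verbatim from pub/pub-ns-dss/ns-imp-p1/rmd/, sha16 a7221f0fa8701014); landed by ns-tc-p1 g5 as the
hand keyed by DIRECTOR-NS #233 (one writer, no re-proof).  WHAT THIS IS NOT: no statement about Navier–Stokes; elementary Lie-group calculus for a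
criterion door on HYPOTHETICAL Type-I blow-up profiles.
-/

noncomputable section

-- the summit and its single problem share the name (D-0017 nested layout)
set_option linter.dupNamespace false

namespace Summit.NavierStokesRegularity.NavierStokesRegularity.Theorems.RigidMotionDoorRigidFlow

open Set Function Filter Topology
open scoped RealInnerProductSpace InnerProductSpace

section Group

variable {E : Type*} [NormedAddCommGroup E] [InnerProductSpace ℝ E] [CompleteSpace E]

omit [CompleteSpace E] in
/-- Polarisation: an operator with vanishing quadratic form is skew, `⟪B x, y⟫ = −⟪B y, x⟫`. -/
theorem inner_map_eq_neg {B : E →L[ℝ] E} (hB : ∀ x, ⟪B x, x⟫ = 0) (x y : E) : ⟪B x, y⟫ = -⟪B y, x⟫ := by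
  have h := hB (x + y)
  rw [map_add, inner_add_left, inner_add_right, inner_add_right, hB x, hB y] at h
  linarith

/-- An operator with vanishing quadratic form is skew-adjoint: `B⋆ = −B`. -/
theorem star_eq_neg {B : E →L[ℝ] E} (hB : ∀ x, ⟪B x, x⟫ = 0) : star B = -B := by
  rw [ContinuousLinearMap.star_eq_adjoint]
  refine ((ContinuousLinearMap.eq_adjoint_iff (-B) B).2 fun x y => ?_).symm
  rw [neg_apply, inner_neg_left, inner_map_eq_neg hB x y, neg_neg, real_inner_comm]

/-- `exp(τB)` is unitary for a skew `B`. -/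
theorem exp_smul_mem_unitary {B : E →L[ℝ] E} (hB : ∀ x, ⟪B x, x⟫ = 0) (τ : ℝ) :
    NormedSpace.exp (τ • B) ∈ unitary (E →L[ℝ] E) := by
  letI : NormedAlgebra ℚ (E →L[ℝ] E) := NormedAlgebra.restrictScalars ℚ ℝ (E →L[ℝ] E)
  refine NormedSpace.exp_mem_unitary_of_mem_skewAdjoint ?_
  rw [skewAdjoint.mem_iff, star_smul, star_trivial, star_eq_neg hB, smul_neg]

/-- Derivative of the orbit `τ ↦ exp(τB) z`: it is `B exp(τB) z`. -/
theorem hasDerivAt_exp_smul_apply (B : E →L[ℝ] E) (z : E) (τ : ℝ) :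
    HasDerivAt (fun σ : ℝ => NormedSpace.exp (σ • B) z) (B (NormedSpace.exp (τ • B) z)) τ := by
  have h := (hasDerivAt_exp_smul_const' B τ).clm_apply (hasDerivAt_const τ z)
  simpa [mul_apply_eq_comp] using h

/-- `exp(τB)` fixes the kernel of `B`. -/
theorem exp_smul_apply_of_map_eq_zero (B : E →L[ℝ] E) {z : E} (hz : B z = 0) (τ : ℝ) :
    NormedSpace.exp (τ • B) z = z := by
  have hd : ∀ σ : ℝ, HasDerivAt (fun σ : ℝ => NormedSpace.exp (σ • B) z) 0 σ := by
    intro σ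
    have h := (hasDerivAt_exp_smul_const B σ).clm_apply (hasDerivAt_const σ z)
    simpa [mul_apply_eq_comp, hz] using h
  have hc := is_const_of_deriv_eq_zero (fun σ => (hd σ).differentiableAt) (fun σ => (hd σ).deriv) τ 0
  simpa [NormedSpace.exp_zero] using hc

omit [CompleteSpace E] in
/-- `B` commutes with `exp(τ(−B))`, applied form. -/
theorem apply_exp_smul_neg_comm (B : E →L[ℝ] E) (τ : ℝ) (w : E) :
    B (NormedSpace.exp (τ • (-B)) w) = NormedSpace.exp (τ • (-B)) (B w) := by
  have hc : Commute B (NormedSpace.exp (τ • (-B))) :=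
    (((Commute.refl B).neg_right).smul_right τ).exp_right
  have h := congrArg (fun T : E →L[ℝ] E => T w) hc.eq
  simpa [mul_apply_eq_comp] using h

/-- `exp(τB) exp(τ(−B)) = 1`, applied form. -/
theorem exp_smul_apply_exp_smul_neg (B : E →L[ℝ] E) (τ : ℝ) (w : E) :
    NormedSpace.exp (τ • B) (NormedSpace.exp (τ • (-B)) w) = w := by
  letI : NormedAlgebra ℚ (E →L[ℝ] E) := NormedAlgebra.restrictScalars ℚ ℝ (E →L[ℝ] E)
  have hc : Commute (τ • B) (τ • (-B)) := (((Commute.refl B).neg_right).smul_right τ).smul_left τ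
  have h := NormedSpace.exp_add_of_commute hc
  have h0 : τ • B + τ • (-B) = 0 := by rw [smul_neg, add_neg_cancel]
  rw [h0, NormedSpace.exp_zero] at h
  have h' := congrArg (fun T : E →L[ℝ] E => T w) h
  simpa [mul_apply_eq_comp] using h'.symm

/-! ### The affine flow of a Killing field -/

omit [CompleteSpace E] in
/-- The affine flow `g_τ(y) = exp(τB) y + (exp(τB) c − c + τ e₂)` of the Killing field `y ↦ B y + (B c + e₂)`
(with `B e₂ = 0` a screw motion about the axis `−c + ker B`; written out, no definition) starts at the identity. -/
theorem flow_zero (B : E →L[ℝ] E) (c e₂ y : E) :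
    NormedSpace.exp ((0 : ℝ) • B) y + (NormedSpace.exp ((0 : ℝ) • B) c - c + (0 : ℝ) • e₂) = y := by
  simp [NormedSpace.exp_zero]

/-- The flow is generated by the Killing field: `d/dτ g_τ(y) = B g_τ(y) + (B c + e₂)`. -/
theorem hasDerivAt_flow (B : E →L[ℝ] E) (c : E) {e₂ : E} (he₂ : B e₂ = 0) (τ : ℝ) (y : E) :
    HasDerivAt (fun σ : ℝ => NormedSpace.exp (σ • B) y + (NormedSpace.exp (σ • B) c - c + σ • e₂))
      (B (NormedSpace.exp (τ • B) y + (NormedSpace.exp (τ • B) c - c + τ • e₂)) + (B c + e₂)) τ := by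
  have h1 := hasDerivAt_exp_smul_apply B y τ
  have h2 := hasDerivAt_exp_smul_apply B c τ
  have h3 : HasDerivAt (fun σ : ℝ => σ • e₂) e₂ τ := by
    simpa using (hasDerivAt_id τ).smul_const e₂
  have h := h1.add ((h2.sub_const c).add h3)
  have hval : B (NormedSpace.exp (τ • B) y) + (B (NormedSpace.exp (τ • B) c) + e₂) =
      B (NormedSpace.exp (τ • B) y + (NormedSpace.exp (τ • B) c - c + τ • e₂)) + (B c + e₂) := by
    simp only [map_add, map_sub, map_smul, he₂, smul_zero, add_zero]
    abel
  exact h.congr_deriv hval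

/-- **Integration of an infinitesimal rigid symmetry.** A differentiable `f` with `Df(y)[B y + (B c + e₂)] = B f(y)`
for all `y` is equivariant under the flow: `f(g_τ y) = exp(τB) f(y)`. -/
theorem apply_flow_eq_of_fderiv (B : E →L[ℝ] E) (c : E) {e₂ : E} (he₂ : B e₂ = 0) {f : E → E}
    (hf : Differentiable ℝ f) (hsym : ∀ y, fderiv ℝ f y (B y + (B c + e₂)) = B (f y)) (τ : ℝ) (y : E) :
    f (NormedSpace.exp (τ • B) y + (NormedSpace.exp (τ • B) c - c + τ • e₂)) = NormedSpace.exp (τ • B) (f y) := by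
  -- the flow `g σ` (written out) and the constant function `φ σ = exp(σ(−B)) f(g σ y)`
  set g : ℝ → E := fun σ => NormedSpace.exp (σ • B) y + (NormedSpace.exp (σ • B) c - c + σ • e₂) with hg_def
  set φ : ℝ → E := fun σ => NormedSpace.exp (σ • (-B)) (f (g σ)) with hφ
  have hd : ∀ σ, HasDerivAt φ 0 σ := by
    intro σ
    have hg := hasDerivAt_flow B c he₂ σ y
    have hfg : HasDerivAt (fun σ' => f (g σ'))
        (fderiv ℝ f (g σ) (B (g σ) + (B c + e₂))) σ :=
      (hf _).hasFDerivAt.comp_hasDerivAt σ hg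
    rw [hsym] at hfg
    have h := (hasDerivAt_exp_smul_const' (-B) σ).clm_apply hfg
    convert h using 1
    rw [mul_apply_eq_comp, neg_apply, apply_exp_smul_neg_comm, neg_add_cancel]
  have hconst := is_const_of_deriv_eq_zero (fun σ => (hd σ).differentiableAt) (fun σ => (hd σ).deriv) τ 0
  have h0 : φ 0 = f y := by
    simp [hφ, hg_def, NormedSpace.exp_zero]
  rw [h0] at hconst
  have h' := congrArg (fun w => NormedSpace.exp (τ • B) w) hconst
  simpa only [hφ, hg_def, exp_smul_apply_exp_smul_neg] using h'

/-- **Differentiation of a finite rigid symmetry.** If a differentiable `f` is equivariant under the flow,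
`f(g_τ y) = exp(τB) f(y)` for all `τ, y`, then `Df(y)[B y + (B c + e₂)] = B f(y)`. -/
theorem fderiv_eq_of_apply_flow (B : E →L[ℝ] E) (c : E) {e₂ : E} (he₂ : B e₂ = 0) {f : E → E}
    (hf : Differentiable ℝ f)
    (hfin : ∀ (τ : ℝ) (y : E), f (NormedSpace.exp (τ • B) y + (NormedSpace.exp (τ • B) c - c + τ • e₂)) =
      NormedSpace.exp (τ • B) (f y)) (y : E) :
    fderiv ℝ f y (B y + (B c + e₂)) = B (f y) := by
  have h1 : HasDerivAt (fun τ : ℝ => f (NormedSpace.exp (τ • B) y + (NormedSpace.exp (τ • B) c - c + τ • e₂)))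
      (fderiv ℝ f y (B y + (B c + e₂))) 0 := by
    have h := (hf (NormedSpace.exp ((0 : ℝ) • B) y + (NormedSpace.exp ((0 : ℝ) • B) c - c + (0 : ℝ) • e₂)))
      |>.hasFDerivAt.comp_hasDerivAt (0 : ℝ) (hasDerivAt_flow B c he₂ 0 y)
    simpa [NormedSpace.exp_zero, Function.comp_def] using h
  have h2 : HasDerivAt (fun τ : ℝ => NormedSpace.exp (τ • B) (f y)) (B (f y)) 0 := by
    simpa [NormedSpace.exp_zero] using hasDerivAt_exp_smul_apply B (f y) 0
  have heq : (fun τ : ℝ => f (NormedSpace.exp (τ • B) y + (NormedSpace.exp (τ • B) c - c + τ • e₂))) =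
      fun τ => NormedSpace.exp (τ • B) (f y) :=
    funext fun τ => hfin τ y
  rw [heq] at h1
  exact h1.unique h2

end Group

section Decomp

variable {E : Type*} [NormedAddCommGroup E] [InnerProductSpace ℝ E] [FiniteDimensional ℝ E]

/-- **Range–kernel splitting for a skew operator** (finite dimension): every `e` is `B c + e₂` with `B e₂ = 0`
(project `e` orthogonally onto `range B`; a vector orthogonal to `range B` is killed by the skew `B`). -/
theorem exists_range_add_ker {B : E →L[ℝ] E} (hB : ∀ x, ⟪B x, x⟫ = 0) (e : E) :
    ∃ c e₂ : E, B e₂ = 0 ∧ e = B c + e₂ := by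
  set K : Submodule ℝ E := LinearMap.range (B : E →ₗ[ℝ] E) with hK
  have hmem : K.starProjection e ∈ K := K.starProjection_apply_mem e
  obtain ⟨c, hc⟩ := LinearMap.mem_range.1 hmem
  refine ⟨c, e - K.starProjection e, ?_, ?_⟩
  · have hz : e - K.starProjection e ∈ Kᗮ := K.sub_starProjection_mem_orthogonal e
    have hBB : B (B (e - K.starProjection e)) ∈ K := LinearMap.mem_range.2 ⟨B (e - K.starProjection e), rfl⟩
    have h0 : ⟪B (e - K.starProjection e), B (e - K.starProjection e)⟫ = 0 := by
      rw [inner_map_eq_neg hB, Submodule.inner_right_of_mem_orthogonal hBB hz, neg_zero]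
    exact inner_self_eq_zero.1 h0
  · have hc' : B c = K.starProjection e := hc
    rw [hc', add_sub_cancel]

end Decomp

end Summit.NavierStokesRegularity.NavierStokesRegularity.Theorems.RigidMotionDoorRigidFlow

end
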